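import Summits.HodgeConjecture.HodgeConjecture.Cruxes.BlochSeedDiscOne.HeightTower
import Summits.HodgeConjecture.HodgeConjecture.Cruxes.BlochSeedDiscOne.DualSupportHonest

/-!
# DualSupportHonestTower — linkage of the support-honest node to `HeightTower.FloorFree` and the nine floors

(plan-lens-HodgeAV-dual g10, 2026-08-30; evidence-side; letters ≠ sheaves; nothing toward HC ∕ 18881.)
`FloorFree h B r ↔ FloorFreeScaled h B r 1`, `FloorFreeSH → FloorFree`, and the instance: the support-honest nodes of the nine
floors close `Nonex 14 199 8` given the kernel-checked rings `≤ 5` — a SUFFICIENT node per height, exactly like the floors.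
-/

set_option linter.dupNamespace false
set_option autoImplicit false

namespace Summit.HodgeConjecture.HodgeConjecture.Cruxes.BlochSeedDiscOne.DualSupportHonest

open DepthBoundA4 IntegralityGap HeightTower

theorem floorFree_iff_scaled_one (h : ℤ) (B : ℕ) (rmin : ℤ) : FloorFree h B rmin ↔ FloorFreeScaled h B rmin 1 :=
  (floorFree_iff_depthBound h B rmin).trans (scaled_one_iff_depthBound h B rmin).symm

theorem floorFree_of_SH {h : ℤ} {B : ℕ} {rmin : ℤ} (H : FloorFreeSH h B rmin) : FloorFree h B rmin :=
  (floorFree_iff_scaled_one h B rmin).2 (H 1 Nat.one_pos)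

theorem floorFree_of_LP {h : ℤ} {B : ℕ} {rmin : ℤ} (H : FloorFreeLP h B rmin) : FloorFree h B rmin :=
  floorFree_of_SH (SH_of_LP H)

theorem floorFree_of_bigSupport {h : ℤ} {B : ℕ} (rmin : ℤ) (H : BigSupport h B) : FloorFree h B rmin :=
  floorFree_of_SH (SH_of_bigSupport rmin H)

/-- the instance of record. -/
theorem nonex_14_of_SH_floors (hR : RingsEmpty 14 199 8 5) (H : ∀ h : ℤ, 6 ≤ h → h ≤ 14 → FloorFreeSH h 199 8) :
    Nonex 14 199 8 :=
  (nonex_14_iff_floors hR).2 fun h h6 h14 => floorFree_of_SH (H h h6 h14)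

end Summit.HodgeConjecture.HodgeConjecture.Cruxes.BlochSeedDiscOne.DualSupportHonest
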